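import Summits.QuantumAdvantage.QuantumAdvantage.Theorems.LinnikCubicClassGroupsDegreeOnePrimesEscapeClassPNTDHInputs
import Summits.QuantumAdvantage.QuantumAdvantage.Theorems.LinnikCubicClassGroupsDegreeOnePrimesEscapeClassPNTSmoothedMain
import Literature.NumberTheory.LFunctions.UniformClassGroupPNTGeneralDegree
import Literature.NumberTheory.LFunctions.UniformClassGroupPNTReduction
import HarnessLib

/-!
# The class prime number theorem with DECAYING error, IV′: small lemmas for the Thorner–Zaman form

Topic `Summits/QuantumAdvantage/QuantumAdvantage/Theorems`, cell B2b-1 (linnik-cubic), PART A (gen 32);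
helper toward the crux `DegreeOnePrimesEscape` (stmt-QuantumAdvantage-11543) of route
`LinnikCubicClassGroups`.  HONEST FRAMING: the value of this file is a THEOREM (kernel-checked) — NOT
summit progress (the route still rests on the hypothesis-type target `PureCubicClassNumberHard`).

Bookkeeping between the cell's vocabulary (the family `F_ψ`, the exceptional segment `excRegion c K`, the
decay shape `𝓓_κ(x) = e^{−κ log x/log Q} + e^{−√(κ log x)}`) and the vocabulary of the tree's named fact
`ThornerZaman2019_classPNT_imaginaryQuadratic` / `…_hilbertClassField` (`UniformClassGroupPNT*.lean`: the
window `1 − 1/(8 log Q) < β < 1`, the error `errorTermN c Q n x = e^{−c log x/log Q} + e^{−√(c log x)/√n}`):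

* (the converse `famF_eq_zero_of_classGroupLFunction` of `classGroupLFunction_eq_zero_of_famF` is in
  `…ClassWindowDH.lean`);
* `decayShape_le_errorTermN` — `𝓓_κ(x) ≤ errorTermN κ Q n x`;
* `log_condQn_ge` — `log|d_K| + log 4 ≤ log Q` (`n ≥ 2`); `window_of_excRegion` — the exceptional segment
  with `c ≤ 1/(8(n²+1))` lies inside the window `(1 − 1/(8 log Q), 1)`; `one_sub_ge_of_not_excRegion` — a
  real point off the segment has `1 − β ≥ c/log Q`;
* `rpow_neg_stark_le` — `Q^{−(2 + max(0, log(1/c₁)))} ≤ c₁ Q^{−2}` (`Q ≥ 12`);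
* `main_ge_half_of_far` — `t − r t^β/β ≥ t/2` for `|r| ≤ 1`, `1/2 ≤ β`, `e^{−(1−β) log t} ≤ 1/8`.

Reference: J. Thorner, A. Zaman, Algebra Number Theory 13 (2019), Thm. 1.4, Thm. 3.1 [ThornerZaman2019].
-/

noncomputable section

open Complex Real MeasureTheory Set Filter Topology
open scoped NumberField nonZeroDivisors

namespace Summit.QuantumAdvantage.QuantumAdvantage.Theorems.DegreeOnePrimesEscape

open Literature.NumberTheory.LFunctions Literature.NumberTheory.LFunctions.NumberField
  Literature.NumberTheory.LFunctions.EntireEF Literature.NumberTheory.LFunctions.TZWeight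
  Literature.NumberTheory.LFunctions.AbelianDensity

variable {K : Type} [Field K] [NumberField K]

/-- **The decay shape is below the printed error term**: for `n ≥ 1` and `log x ≥ 0`,
`e^{−κ log x/log Q} + e^{−√(κ log x)} ≤ errorTermN κ Q n x = e^{−κ log x/log Q} + e^{−√(κ log x)/√n}`.
[cite: ThornerZaman2019, Thm. 1.1] -/
theorem decayShape_le_errorTermN {κ Q x : ℝ} {n : ℕ} (hn : 1 ≤ n) :
    Real.exp (-(κ * Real.log x / Real.log Q)) + Real.exp (-Real.sqrt (κ * Real.log x)) ≤
      ThornerZaman.errorTermN κ Q n x := by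
  rw [ThornerZaman.errorTermN]
  refine add_le_add le_rfl ?_
  rw [Real.exp_le_exp, neg_le_neg_iff]
  have hn1 : (1 : ℝ) ≤ Real.sqrt n := by
    rw [Real.le_sqrt (by norm_num) (Nat.cast_nonneg n)]; norm_num; exact_mod_cast hn
  have h0 : 0 ≤ Real.sqrt (κ * Real.log x) := Real.sqrt_nonneg _
  rw [div_le_iff₀ (by linarith)]
  nlinarith

/-- `log|d_K| + log 4 ≤ log Q` for `Q = |d_K| n^n`, `n = [K:ℚ] ≥ 2` (`n^n ≥ 4`). [folklore] -/
theorem log_condQn_ge (hK : 1 < Module.finrank ℚ K) :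
    Real.log ((NumberField.discr K).natAbs : ℝ) + Real.log 4 ≤ Real.log (ThornerZaman.condQn K) := by
  have hd0 : (0 : ℝ) < ((NumberField.discr K).natAbs : ℝ) := by
    exact_mod_cast Nat.pos_of_ne_zero (Int.natAbs_ne_zero.2 (NumberField.discr_ne_zero K))
  have hn2 : (2 : ℝ) ≤ Module.finrank ℚ K := by exact_mod_cast hK
  have hnn : (4 : ℝ) ≤ (Module.finrank ℚ K : ℝ) ^ Module.finrank ℚ K := by
    calc (4 : ℝ) = 2 ^ 2 := by norm_num
      _ ≤ (Module.finrank ℚ K : ℝ) ^ 2 := by gcongr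
      _ ≤ (Module.finrank ℚ K : ℝ) ^ Module.finrank ℚ K :=
          pow_le_pow_right₀ (by linarith) hK
  have hQ : ThornerZaman.condQn K = ((NumberField.discr K).natAbs : ℝ) *
      (Module.finrank ℚ K : ℝ) ^ Module.finrank ℚ K := by
    rw [ThornerZaman.condQn, Nat.cast_natAbs, Int.cast_abs]
  rw [hQ, Real.log_mul hd0.ne' (by positivity)]
  have := Real.log_le_log (by norm_num) hnn
  linarith

/-- **The exceptional segment lies inside the Thorner–Zaman window**: if `c ≤ 1/(8(n²+1))`, `n = [K:ℚ] > 1`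
and `ρ ∈ excRegion c K` then `1 − 1/(8 log Q) < Re ρ` (`8c log Q ≤ log Q/(n²+1) ≤ log|d_K| + log 4`,
as `n log n ≤ n² log 4`). [cite: ThornerZaman2019, Thm. 3.1] -/
theorem window_of_excRegion {n : ℕ} (hn : 1 < n) (hKn : Module.finrank ℚ K = n) {c : ℝ}
    (hcn : c ≤ 1 / (8 * ((n : ℝ) ^ 2 + 1))) {ρ : ℂ} (hexc : excRegion c K ρ) :
    1 - 1 / (8 * Real.log (ThornerZaman.condQn K)) < ρ.re := by
  have hK : 1 < Module.finrank ℚ K := by rw [hKn]; exact hn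
  have hn2 : (2 : ℝ) ≤ n := by exact_mod_cast hn
  set Q : ℝ := ThornerZaman.condQn K with hQdef
  have hQ12 : (12 : ℝ) ≤ Q := ThornerZaman.twelve_le_condQn (K := K) hK
  have hlogQ : 2 ≤ Real.log Q := two_lt_log_twelve.le.trans (Real.log_le_log (by norm_num) hQ12)
  have hd0 : (0 : ℝ) < ((NumberField.discr K).natAbs : ℝ) := by
    exact_mod_cast Nat.pos_of_ne_zero (Int.natAbs_ne_zero.2 (NumberField.discr_ne_zero K))
  have hlogd : 0 ≤ Real.log ((NumberField.discr K).natAbs : ℝ) := Real.log_natCast_nonneg _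
  have hlog4 : 1 < Real.log 4 := by
    rw [show (4:ℝ) = 2 ^ 2 by norm_num, Real.log_pow]; have := Real.log_two_gt_d9; push_cast; linarith
  -- `log Q = log|d| + n log n` and `n log n ≤ n² log 4`
  have hQ : Q = ((NumberField.discr K).natAbs : ℝ) * (n : ℝ) ^ n := by
    rw [hQdef, ThornerZaman.condQn, Nat.cast_natAbs, Int.cast_abs, hKn]
  have hlogQeq : Real.log Q = Real.log ((NumberField.discr K).natAbs : ℝ) + n * Real.log n := by
    rw [hQ, Real.log_mul hd0.ne' (by positivity), Real.log_pow]
  have hlogn : Real.log n ≤ n * Real.log 4 := by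
    have h1 : Real.log (n : ℝ) ≤ n := by
      have := Real.log_le_sub_one_of_pos (by linarith : (0 : ℝ) < n); linarith
    nlinarith
  have hnlogn : (n : ℝ) * Real.log n ≤ ((n : ℝ) ^ 2 + 1) * (Real.log ((NumberField.discr K).natAbs : ℝ) +
      Real.log 4) := by
    have h0 : 0 ≤ Real.log (n : ℝ) := Real.log_natCast_nonneg _
    nlinarith
  -- hence `c/(log|d| + log 4) ≤ 1/(8 log Q)`
  have hden : 0 < Real.log ((NumberField.discr K).natAbs : ℝ) + Real.log 4 := by linarith
  have hkey : c / (Real.log ((NumberField.discr K).natAbs : ℝ) + Real.log 4) ≤ 1 / (8 * Real.log Q) := by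
    rw [div_le_div_iff₀ hden (by positivity), one_mul]
    have h1 : c * (8 * Real.log Q) ≤ 1 / (8 * ((n : ℝ) ^ 2 + 1)) * (8 * Real.log Q) :=
      mul_le_mul_of_nonneg_right hcn (by positivity)
    have e : 1 / (8 * ((n : ℝ) ^ 2 + 1)) * (8 * Real.log Q) = Real.log Q / ((n : ℝ) ^ 2 + 1) := by
      field_simp
    have h2 : Real.log Q / ((n : ℝ) ^ 2 + 1) ≤ Real.log ((NumberField.discr K).natAbs : ℝ) + Real.log 4 := by
      rw [div_le_iff₀ (by positivity), hlogQeq]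
      nlinarith
    linarith [e ▸ h1]
  obtain ⟨him, hre⟩ := hexc
  linarith

/-- **A real point off the exceptional segment is `≥ c/log Q` away from `1`**: if `¬ excRegion c K β` for a
real `β` then `c/log Q ≤ 1 − β` (`log|d_K| + log 4 ≤ log Q`). [folklore] -/
theorem one_sub_ge_of_not_excRegion (hK : 1 < Module.finrank ℚ K) {c β : ℝ} (hc : 0 < c)
    (hexc : ¬ excRegion c K (β : ℂ)) : c / Real.log (ThornerZaman.condQn K) ≤ 1 - β := by
  have hQ12 : (12 : ℝ) ≤ ThornerZaman.condQn K := ThornerZaman.twelve_le_condQn (K := K) hK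
  have hlogQ : 2 ≤ Real.log (ThornerZaman.condQn K) :=
    two_lt_log_twelve.le.trans (Real.log_le_log (by norm_num) hQ12)
  have hlogd : 0 ≤ Real.log ((NumberField.discr K).natAbs : ℝ) := Real.log_natCast_nonneg _
  have hlog4 : 0 < Real.log 4 := Real.log_pos (by norm_num)
  have hle := log_condQn_ge (K := K) hK
  rw [excRegion, not_and, Complex.ofReal_im, Complex.ofReal_re] at hexc
  have h1 : ¬ (1 - c / (Real.log ((NumberField.discr K).natAbs : ℝ) + Real.log 4) < β) := hexc rfl
  rw [not_lt] at h1
  have h2 : c / Real.log (ThornerZaman.condQn K) ≤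
      c / (Real.log ((NumberField.discr K).natAbs : ℝ) + Real.log 4) :=
    div_le_div_of_nonneg_left hc.le (by linarith) hle
  linarith

/-- **Stark's `c₁ Q^{−2}` dominates a power of `Q`**: for `Q ≥ 12` and `0 < c₁`,
`Q^{−(2 + max(0, log(1/c₁)))} ≤ c₁ Q^{−2}`. [folklore] -/
theorem rpow_neg_stark_le {Q c₁ : ℝ} (hQ : 12 ≤ Q) (hc₁ : 0 < c₁) :
    Q ^ (-(2 + max 0 (Real.log (1 / c₁)))) ≤ c₁ * Q ^ (-(2 : ℝ)) := by
  have hQ0 : 0 < Q := by linarith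
  set m : ℝ := max 0 (Real.log (1 / c₁)) with hm
  have hm0 : 0 ≤ m := le_max_left _ _
  have hsplit : Q ^ (-(2 + m)) = Q ^ (-(2 : ℝ)) * Q ^ (-m) := by
    rw [← Real.rpow_add hQ0]; ring_nf
  have hQm : Q ^ (-m) ≤ c₁ := by
    have hlog12 : (1 : ℝ) ≤ Real.log 12 := by
      rw [Real.le_log_iff_exp_le (by norm_num)]
      have := Real.exp_one_lt_d9; linarith
    have hlogQ : 1 ≤ Real.log Q := hlog12.trans (Real.log_le_log (by norm_num) hQ)
    have h1 : Q ^ (-m) ≤ Real.exp (-m) := by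
      rw [Real.rpow_def_of_pos hQ0, Real.exp_le_exp]; nlinarith
    have h2 : Real.exp (-m) ≤ c₁ := by
      rw [Real.exp_neg]
      have h3 : 1 / c₁ ≤ Real.exp m := by
        calc 1 / c₁ = Real.exp (Real.log (1 / c₁)) := (Real.exp_log (by positivity)).symm
          _ ≤ Real.exp m := Real.exp_le_exp.2 (le_max_right _ _)
      calc (Real.exp m)⁻¹ ≤ (1 / c₁)⁻¹ := inv_anti₀ (by positivity) h3
        _ = c₁ := by rw [one_div, inv_inv]
    exact h1.trans h2
  rw [hsplit, mul_comm]
  exact mul_le_mul_of_nonneg_right hQm (Real.rpow_nonneg hQ0.le _)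

/-- **The main term with a far real zero is at least `t/2`**: for `t > 1`, `|r| ≤ 1`, `1/2 ≤ β` and
`e^{−(1 − β) log t} ≤ 1/8`: `t/2 ≤ t − r t^β/β` and `|r| t^β/β ≤ t/2`. [folklore] -/
theorem main_ge_half_of_far {t β r : ℝ} (ht : 1 < t) (hr : |r| ≤ 1) (hβ : 1 / 2 ≤ β)
    (hfar : Real.exp (-((1 - β) * Real.log t)) ≤ 1 / 8) :
    t / 2 ≤ t - r * t ^ β / β ∧ |r| * (t ^ β / β) ≤ t / 2 := by
  have ht0 : 0 < t := by linarith
  have hβ0 : 0 < β := by linarith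
  have htβ : t ^ β = t * Real.exp (-((1 - β) * Real.log t)) := by
    rw [Real.rpow_def_of_pos ht0, show Real.log t * β = Real.log t + -((1 - β) * Real.log t) by ring,
      Real.exp_add, Real.exp_log ht0]
  have htβ0 : 0 < t ^ β := Real.rpow_pos_of_pos ht0 β
  have h1 : t ^ β / β ≤ t / 2 := by
    rw [div_le_iff₀ hβ0, htβ]
    have := mul_le_mul_of_nonneg_left hfar ht0.le
    nlinarith
  have h2 : |r| * (t ^ β / β) ≤ t / 2 := by
    calc |r| * (t ^ β / β) ≤ 1 * (t ^ β / β) := mul_le_mul_of_nonneg_right hr (by positivity)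
      _ = t ^ β / β := one_mul _
      _ ≤ t / 2 := h1
  refine ⟨?_, h2⟩
  have h3 : r * t ^ β / β ≤ |r| * (t ^ β / β) := by
    rw [mul_div_assoc]
    exact mul_le_mul_of_nonneg_right (le_abs_self r) (by positivity)
  linarith

end Summit.QuantumAdvantage.QuantumAdvantage.Theorems.DegreeOnePrimesEscape

end
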